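/-
Copyright (c) 2026 the pub-hodgecm-mathlib formalisation cell (harness21).  Prover seat hodgecm-mathlib-F0P3a-p01 (g16): road «S3-ram» (LEAD F0P3a-plan (g12); architect
A-p16 (g31) 22:49:18Z «(a2) SHELL SUMS → p01»), organ A′ (ii) (a2), gap G4 «B1 FORM TRANSPORT» of BLUEPRINT-a2B v1; 2026-09-01.
-/
import Literature.NumberTheory.Automorphic.UnitaryLatticeTreeDual          -- ★ `pairing_mulVec_mulVec` (Gram matrix of `latt g` is `formCongr σ g H`); brings ★ `UnitaryLatticeTreeDefs`
import Literature.NumberTheory.Automorphic.UnitaryLatticeTreeFrameChange   -- ★ (F0P2-p06 (g10)) `isVertexLattice_formCongr_iff`, `isVertex_formCongr_iff`, `isSelfDualLattice_formCongr_iff`, `mapGL_conj_mapGL_eq_iff`, `mapGL_inv_mapGL`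
import Literature.NumberTheory.Rogawski1990.UnitaryVertexStabilizerSpanSelfDualRamifiedCM   -- ★ (F0P2-p06 (g10)) `isVertexLattice_smul_iff` (unit rescaling of the form)
import HarnessLib

/-!
# The lattice graph of a hermitian space — change of MODEL: a change of basis `P ∈ GL_N(K)` carries the lattice graph of `ᵗσ(P) H P` isomorphically onto that of `H`,
# with vertex types, fixed vertices and the level ∕ class labels of a fixed vertex (Bruhat–Tits 1972 §10; Kottwitz 1986 §3; Serre, *Trees* II.1.1)

Topic `NumberTheory/Automorphic`; namespace `Literature.NumberTheory.Automorphic.UnitaryLatticeTree`.  THEOREMS ONLY (no definition, no instance, no notation, no named fact,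
no `sorry`); kernel lane `--supports stmt-HodgeConjecture-24833`; datum-free (`K` any field with `Valued K ℤᵐ⁰`, `σ` any ring endomorphism, any rank `N`).  Cell
`pub/hodgecm-mathlib` (D-0151), crux H413; road «S3-ram» (Literature seeding, count-neutral), P-1-ram organ A′ (ii) (a2) «SHELL SUMS», gap **G4∕B1 «FORM TRANSPORT»** of the
blueprint `F0/P3a/F0P3a-p01/g16/rootbook/BLUEPRINT-a2B-TreeInduction.v1…md` §1: the tree of the tame-ramified `U(3)` is proved for the ANTIDIAGONAL model `J₀` (★
`isTree_latticeGraph_three_of_neg`), the consumer's counts live on the CM place form `H′_w = c·ᵗσ(A) J₀ A` (★ p847154), and the root bookkeeping of a type-(1) literal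
`t = P·diag(λ)·P⁻¹` is done in its EIGENFRAME, i.e. for the DIAGONAL form `ᵗσ(P) H P = diag(d)` (★ `UnitaryLatticeTreeSeparableStableRoot`, ★ `…IsolatedIndexStableRoot`, ★
`DepthZeroKappaTransferTypeOneRamifiedRootTwists`).  This file is the dictionary between any two such models.

THE MATHEMATICS (elementary).  For `P ∈ GL_N(K)` and `H′ := formCongr σ P H = ᵗσ(P) H P`: the Gram matrix of `latt (P g)` for `H` is that of `latt g` for `H′` (★ `formCongr_formCongr`),
so `M` is a vertex lattice of type `d` for `H′` iff `P·M` is one for `H` (★ `UnitaryLatticeTreeFrameChange`, F0P2-p06 (g10) — imported, §2 only adds the backward reading); (§1) rescaling the form by a UNIT scalar changes nothing (★ `isVertexLattice_smul_iff`); (§3) `M ↦ P·M` is therefore a graph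
ISOMORPHISM `latticeGraph σ ϖ H′ ≃g latticeGraph σ ϖ H` (adjacency = strict inclusion is preserved, ★ `mapGL_lt_mapGL_iff`) — stated as an EXISTENCE (`∃ φ, ∀ v, (φ v).1 = P·v.1`)
since this file defines nothing — whence `IsTree` moves between models (Mathlib `Iso.isTree_iff`); (§4) under `M ↦ P·M`, `γ ↦ PγP⁻¹`: fixedness `γM = M`, the LEVEL token
`(γ − 1)M ⊆ c·M` (and its square `(γ − 1)²M ⊆ c·M`), and the CLASS token «`ϖ'·B(y, (γ−1)y) ≡ c·a²`, `|a| = 1`, for some `y ∈ M`» are invariant (`B_H(Py, Pz) = B_{H′}(y, z)`, ★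
`pairing_mulVec_mulVec`) — so each of the five strata counts of the (a2) token sheet `TOKENS-a2-LatticeLabels.v1` is the same in the two models (§5, as equalities of `Set.ncard`
along the injection `mapGL P`).
HONEST LABEL: HC_CM is proved only modulo the 2 remaining named inputs (hLiu418 24832, h413 24833) until rung 0 closes; nothing printed is asserted here (change of basis).

## References
* [BruhatTits1972] F. Bruhat, J. Tits, *Groupes réductifs sur un corps local I*, Publ. Math. IHÉS 41 (1972), §10 (the building of a rank-one group; functoriality in the form).
* [Kottwitz1986] R. E. Kottwitz, *Base change for unit elements of Hecke algebras*, Compositio Math. 60 (1986), §3 (counting `γ`-fixed lattices in a convenient basis).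
* [Serre1980Trees] J.-P. Serre, *Trees* (1980), Ch. II §1.1 (the tree of lattice classes; `GL`-equivariance).
* [Jacobowitz1962] R. Jacobowitz, *Hermitian forms over local fields*, Amer. J. Math. 84 (1962), §4 (Gram matrices under change of basis).
-/

set_option autoImplicit false

noncomputable section

open scoped Valued WithZero Matrix MatrixGroups

namespace Literature.NumberTheory.Automorphic.UnitaryLatticeTree

open Literature.NumberTheory.Automorphic Literature.NumberTheory.Automorphic.HermitianLattice

variable {K : Type*} [Field K] [Valued K ℤᵐ⁰] {N : ℕ}

/-! ## §1 Rescaling the form by a unit scalar (★ `isVertexLattice_smul_iff`, F0P2-p06 (g10)) -/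

/-- `IsVertex σ ϖ (c • H) M ↔ IsVertex σ ϖ H M` for `|c| = 1`. [cite: BruhatTits1972, §10] -/
theorem isVertex_smul_form_iff (σ : K →+* K) (ϖ : K) {c : K} (hc : Valued.v c = 1) (H : Matrix (Fin N) (Fin N) K) (M : Submodule 𝒪[K] (Fin N → K)) :
    IsVertex σ ϖ (c • H) M ↔ IsVertex σ ϖ H M :=
  exists_congr fun d => isVertexLattice_smul_iff (σ := σ) (ϖ := ϖ) hc H d M

/-! ## §2 Change of basis (★ `UnitaryLatticeTreeFrameChange`: `isVertexLattice_formCongr_iff` etc.) — the inverse direction -/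

/-- `IsVertex σ ϖ (ᵗσ(P) H P) (P⁻¹·M) ↔ IsVertex σ ϖ H M` (★ `isVertex_formCongr_iff` read backwards). [cite: BruhatTits1972, §10] -/
theorem isVertex_formCongr_mapGL_inv_iff (σ : K →+* K) (ϖ : K) (H : Matrix (Fin N) (Fin N) K) (P : GL (Fin N) K) (M : Submodule 𝒪[K] (Fin N → K)) :
    IsVertex σ ϖ (formCongr σ P H) (mapGL P⁻¹ M) ↔ IsVertex σ ϖ H M := by
  rw [isVertex_formCongr_iff (σ := σ) (ϖ := ϖ), mapGL_mapGL_inv]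

/-! ## §3 The graph isomorphism `M ↦ P·M` between the two models, and the tree property -/

/-- **THE TWO MODELS HAVE ISOMORPHIC LATTICE GRAPHS**: for any `P ∈ GL_N(K)` there is a graph isomorphism `latticeGraph σ ϖ (ᵗσ(P) H P) ≃g latticeGraph σ ϖ H` acting on
the underlying lattices by `M ↦ P·M` (vertices correspond by §2, adjacency = strict inclusion is preserved by ★ `mapGL_lt_mapGL_iff`).  Stated as an existence: this file
defines nothing. [cite: BruhatTits1972, §10] [cite: Serre1980Trees, II.1.1] -/
theorem exists_iso_latticeGraph_formCongr (σ : K →+* K) (ϖ : K) (H : Matrix (Fin N) (Fin N) K) (P : GL (Fin N) K) :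
    ∃ φ : latticeGraph σ ϖ (formCongr σ P H) ≃g latticeGraph σ ϖ H,
      ∀ v, ((φ v : {M : Submodule 𝒪[K] (Fin N → K) // IsVertex σ ϖ H M}) : Submodule 𝒪[K] (Fin N → K)) = mapGL P v.1 := by
  let e : {M : Submodule 𝒪[K] (Fin N → K) // IsVertex σ ϖ (formCongr σ P H) M} ≃ {M : Submodule 𝒪[K] (Fin N → K) // IsVertex σ ϖ H M} :=
    { toFun := fun v => ⟨mapGL P v.1, (isVertex_formCongr_iff (σ := σ) (ϖ := ϖ) P H v.1).1 v.2⟩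
      invFun := fun w => ⟨mapGL P⁻¹ w.1, (isVertex_formCongr_mapGL_inv_iff σ ϖ H P w.1).2 w.2⟩
      left_inv := fun v => by
        apply Subtype.ext
        change mapGL P⁻¹ (mapGL P v.1) = v.1
        rw [← mapGL_mul, inv_mul_cancel, mapGL_one]
      right_inv := fun w => by
        apply Subtype.ext
        change mapGL P (mapGL P⁻¹ w.1) = w.1
        rw [← mapGL_mul, mul_inv_cancel, mapGL_one] }
  refine ⟨⟨e, ?_⟩, fun v => rfl⟩
  intro v w
  change (latticeGraph σ ϖ H).Adj ⟨mapGL P v.1, _⟩ ⟨mapGL P w.1, _⟩ ↔ (latticeGraph σ ϖ (formCongr σ P H)).Adj v w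
  rw [latticeGraph_adj_iff, latticeGraph_adj_iff]
  simp only [mapGL_lt_mapGL_iff]

/-- **A UNIT RESCALING OF THE FORM GIVES THE SAME GRAPH**: a graph isomorphism `latticeGraph σ ϖ (c • H) ≃g latticeGraph σ ϖ H` which is the IDENTITY on underlying lattices
(`|c| = 1`; the two vertex predicates are equivalent by §1). [cite: BruhatTits1972, §10] -/
theorem exists_iso_latticeGraph_smul_form (σ : K →+* K) (ϖ : K) {c : K} (hc : Valued.v c = 1) (H : Matrix (Fin N) (Fin N) K) :
    ∃ φ : latticeGraph σ ϖ (c • H) ≃g latticeGraph σ ϖ H,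
      ∀ v, ((φ v : {M : Submodule 𝒪[K] (Fin N → K) // IsVertex σ ϖ H M}) : Submodule 𝒪[K] (Fin N → K)) = v.1 := by
  let e : {M : Submodule 𝒪[K] (Fin N → K) // IsVertex σ ϖ (c • H) M} ≃ {M : Submodule 𝒪[K] (Fin N → K) // IsVertex σ ϖ H M} :=
    { toFun := fun v => ⟨v.1, (isVertex_smul_form_iff σ ϖ hc H v.1).1 v.2⟩
      invFun := fun w => ⟨w.1, (isVertex_smul_form_iff σ ϖ hc H w.1).2 w.2⟩
      left_inv := fun v => rfl
      right_inv := fun w => rfl }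
  refine ⟨⟨e, ?_⟩, fun v => rfl⟩
  intro v w
  change (latticeGraph σ ϖ H).Adj ⟨v.1, _⟩ ⟨w.1, _⟩ ↔ (latticeGraph σ ϖ (c • H)).Adj v w
  rw [latticeGraph_adj_iff, latticeGraph_adj_iff]

/-- **THE TREE PROPERTY MOVES BETWEEN MODELS**: `latticeGraph σ ϖ (ᵗσ(P) H P)` is a tree iff `latticeGraph σ ϖ H` is (Mathlib `SimpleGraph.Iso.isTree_iff` along §3) — e.g. from
the antidiagonal model ★ `isTree_latticeGraph_three_of_neg` to a literal's diagonal eigenframe model. [cite: BruhatTits1972, §10] [cite: Serre1980Trees, II.1.1] -/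
theorem isTree_latticeGraph_formCongr_iff (σ : K →+* K) (ϖ : K) (H : Matrix (Fin N) (Fin N) K) (P : GL (Fin N) K) :
    (latticeGraph σ ϖ (formCongr σ P H)).IsTree ↔ (latticeGraph σ ϖ H).IsTree := by
  obtain ⟨φ, -⟩ := exists_iso_latticeGraph_formCongr σ ϖ H P
  exact φ.isTree_iff


/-! ## §4 Fixed vertices and the labels of a fixed vertex under the change of model `M ↦ P·M`, `γ ↦ PγP⁻¹` -/

omit [Valued K ℤᵐ⁰] in
/-- `(PγP⁻¹) − 1 = P (γ − 1) P⁻¹`. [folklore] -/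
private theorem coe_conj_sub_one (P γ : GL (Fin N) K) :
    ((P * γ * P⁻¹ : GL (Fin N) K) : Matrix (Fin N) (Fin N) K) - 1 =
      (P : Matrix (Fin N) (Fin N) K) * ((γ : Matrix (Fin N) (Fin N) K) - 1) * ((P⁻¹ : GL (Fin N) K) : Matrix (Fin N) (Fin N) K) := by
  rw [Matrix.mul_sub, Matrix.sub_mul, Matrix.mul_one, Units.val_mul, Units.val_mul, Units.mul_inv]

omit [Valued K ℤᵐ⁰] in
/-- `((PγP⁻¹) − 1)² = P (γ − 1)² P⁻¹`. [folklore] -/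
private theorem coe_conj_sub_one_sq (P γ : GL (Fin N) K) :
    (((P * γ * P⁻¹ : GL (Fin N) K) : Matrix (Fin N) (Fin N) K) - 1) ^ 2 =
      (P : Matrix (Fin N) (Fin N) K) * (((γ : Matrix (Fin N) (Fin N) K) - 1) ^ 2) * ((P⁻¹ : GL (Fin N) K) : Matrix (Fin N) (Fin N) K) := by
  rw [coe_conj_sub_one, pow_two, pow_two]
  simp only [Matrix.mul_assoc]
  rw [← Matrix.mul_assoc ((P⁻¹ : GL (Fin N) K) : Matrix (Fin N) (Fin N) K) (P : Matrix (Fin N) (Fin N) K), Units.inv_mul, Matrix.one_mul]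

/-- The image of `P·M` under `P A P⁻¹` is `P·(A M)`. [cite: Serre1980Trees, II.1.1] -/
theorem map_toLin'_conj_mapGL (P : GL (Fin N) K) (A : Matrix (Fin N) (Fin N) K) (M : Submodule 𝒪[K] (Fin N → K)) :
    (mapGL P M).map ((Matrix.toLin' ((P : Matrix (Fin N) (Fin N) K) * A * ((P⁻¹ : GL (Fin N) K) : Matrix (Fin N) (Fin N) K))).restrictScalars 𝒪[K]) =
      mapGL P (M.map ((Matrix.toLin' A).restrictScalars 𝒪[K])) := by
  change (M.map _).map _ = (M.map _).map _
  rw [← map_toLin'_mul, ← map_toLin'_mul, Matrix.mul_assoc ((P : Matrix (Fin N) (Fin N) K) * A), Units.inv_mul, Matrix.mul_one]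

/-- **THE LEVEL TOKEN TRANSPORTS** (general operator): `(P A P⁻¹)(P·M) ⊆ c·(P·M) ↔ A M ⊆ c·M`. [cite: Kottwitz1986, §3] -/
theorem map_toLin'_conj_mapGL_le_scaleLattice_iff (P : GL (Fin N) K) (A : Matrix (Fin N) (Fin N) K) (c : K) (M : Submodule 𝒪[K] (Fin N → K)) :
    (mapGL P M).map ((Matrix.toLin' ((P : Matrix (Fin N) (Fin N) K) * A * ((P⁻¹ : GL (Fin N) K) : Matrix (Fin N) (Fin N) K))).restrictScalars 𝒪[K]) ≤ scaleLattice c (mapGL P M) ↔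
      M.map ((Matrix.toLin' A).restrictScalars 𝒪[K]) ≤ scaleLattice c M := by
  rw [map_toLin'_conj_mapGL, ← mapGL_scaleLattice, mapGL_le_mapGL_iff]

/-- **THE LEVEL TOKEN `(γ − 1)M ⊆ c·M` TRANSPORTS** under `M ↦ P·M`, `γ ↦ PγP⁻¹` (the depth `d_M ≥ d` token of the (a2) label sheet, `c = ϖ^d`; ★ p847156 `hlev`).
[cite: Kottwitz1986, §3] [cite: Rogawski1990, §4.9 Lemma 4.9.3] -/
theorem map_conj_sub_one_le_scaleLattice_iff (P γ : GL (Fin N) K) (c : K) (M : Submodule 𝒪[K] (Fin N → K)) :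
    (mapGL P M).map ((Matrix.toLin' (((P * γ * P⁻¹ : GL (Fin N) K) : Matrix (Fin N) (Fin N) K) - 1)).restrictScalars 𝒪[K]) ≤ scaleLattice c (mapGL P M) ↔
      M.map ((Matrix.toLin' ((γ : Matrix (Fin N) (Fin N) K) - 1)).restrictScalars 𝒪[K]) ≤ scaleLattice c M := by
  rw [coe_conj_sub_one, map_toLin'_conj_mapGL_le_scaleLattice_iff]

/-- **THE SQUARE LEVEL TOKEN `(γ − 1)²M ⊆ c·M` TRANSPORTS** (the rank token of the (a2) label sheet at depth `d`, `c = ϖ^{2d+1}`). [cite: Kottwitz1986, §3] -/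
theorem map_conj_sub_one_sq_le_scaleLattice_iff (P γ : GL (Fin N) K) (c : K) (M : Submodule 𝒪[K] (Fin N → K)) :
    (mapGL P M).map ((Matrix.toLin' ((((P * γ * P⁻¹ : GL (Fin N) K) : Matrix (Fin N) (Fin N) K) - 1) ^ 2)).restrictScalars 𝒪[K]) ≤ scaleLattice c (mapGL P M) ↔
      M.map ((Matrix.toLin' (((γ : Matrix (Fin N) (Fin N) K) - 1) ^ 2)).restrictScalars 𝒪[K]) ≤ scaleLattice c M := by
  rw [coe_conj_sub_one_sq, map_toLin'_conj_mapGL_le_scaleLattice_iff]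

omit [Valued K ℤᵐ⁰] in
/-- `(P A P⁻¹)(P y) = P (A y)`. [folklore] -/
private theorem conj_mulVec_mulVec (P : GL (Fin N) K) (A : Matrix (Fin N) (Fin N) K) (y : Fin N → K) :
    ((P : Matrix (Fin N) (Fin N) K) * A * ((P⁻¹ : GL (Fin N) K) : Matrix (Fin N) (Fin N) K)) *ᵥ ((P : Matrix (Fin N) (Fin N) K) *ᵥ y) =
      (P : Matrix (Fin N) (Fin N) K) *ᵥ (A *ᵥ y) := by
  rw [Matrix.mulVec_mulVec, Matrix.mul_assoc ((P : Matrix (Fin N) (Fin N) K) * A), Units.inv_mul, Matrix.mul_one, ← Matrix.mulVec_mulVec]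

/-- **THE VALUE TOKEN TRANSPORTS** (general operator and predicate): the values `B_H(y′, (P A P⁻¹) y′)` over `y′ ∈ P·M` are the values `B_{ᵗσ(P)HP}(y, A y)` over `y ∈ M` (★
`pairing_mulVec_mulVec`); hence any predicate of one such value is witnessed in one model iff in the other. [cite: Jacobowitz1962, §4] [cite: Kottwitz1986, §3] -/
theorem exists_mem_mapGL_pairing_conj_iff (σ : K →+* K) (H : Matrix (Fin N) (Fin N) K) (P : GL (Fin N) K) (A : Matrix (Fin N) (Fin N) K)
    (M : Submodule 𝒪[K] (Fin N → K)) (R : K → Prop) :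
    (∃ y ∈ mapGL P M, R (pairing σ H y (((P : Matrix (Fin N) (Fin N) K) * A * ((P⁻¹ : GL (Fin N) K) : Matrix (Fin N) (Fin N) K)) *ᵥ y))) ↔
      ∃ y ∈ M, R (pairing σ (formCongr σ P H) y (A *ᵥ y)) := by
  constructor
  · rintro ⟨y', hy', hR⟩
    obtain ⟨y, hy, rfl⟩ := Submodule.mem_map.1 hy'
    refine ⟨y, hy, ?_⟩
    rw [LinearMap.restrictScalars_apply, Matrix.toLin'_apply, conj_mulVec_mulVec, pairing_mulVec_mulVec] at hR
    exact hR
  · rintro ⟨y, hy, hR⟩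
    refine ⟨(P : Matrix (Fin N) (Fin N) K) *ᵥ y, Submodule.mem_map.2 ⟨y, hy, rfl⟩, ?_⟩
    rw [conj_mulVec_mulVec, pairing_mulVec_mulVec]
    exact hR

/-- **THE CLASS TOKEN OF THE (a2) LABEL SHEET TRANSPORTS**: «some `y ∈ M` has `ϖ′·B(y, (γ − 1)y) ≡ c·a²` with `|a| = 1`» holds for `(H, PγP⁻¹, P·M)` iff for `(ᵗσ(P)HP, γ, M)`.
[cite: Jacobowitz1962, §4] [cite: Rogawski1990, §4.9 p. 55] -/
theorem exists_mem_mapGL_class_iff (σ : K →+* K) (H : Matrix (Fin N) (Fin N) K) (P γ : GL (Fin N) K) (ϖ' c : K) (M : Submodule 𝒪[K] (Fin N → K)) :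
    (∃ y ∈ mapGL P M, ∃ a : K, Valued.v a = 1 ∧
        Valued.v (ϖ' * pairing σ H y ((((P * γ * P⁻¹ : GL (Fin N) K) : Matrix (Fin N) (Fin N) K) - 1) *ᵥ y) - c * a ^ 2) < 1) ↔
      ∃ y ∈ M, ∃ a : K, Valued.v a = 1 ∧ Valued.v (ϖ' * pairing σ (formCongr σ P H) y (((γ : Matrix (Fin N) (Fin N) K) - 1) *ᵥ y) - c * a ^ 2) < 1 := by
  rw [coe_conj_sub_one]
  exact exists_mem_mapGL_pairing_conj_iff σ H P _ M (fun x => ∃ a : K, Valued.v a = 1 ∧ Valued.v (ϖ' * x - c * a ^ 2) < 1)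

/-! ## §5 The strata counts agree in the two models -/

/-- **COUNT TRANSPORT (general label)**: if a label `Q₁` of lattices in the `H`-model corresponds to `Q₂` in the `ᵗσ(P)HP`-model under `M ↦ P·M`, then
`#{M self-dual for H, (PγP⁻¹)M = M, Q₁ M} = #{M self-dual for ᵗσ(P)HP, γM = M, Q₂ M}` — the first set is the image of the second under the injection `mapGL P`.
[cite: Kottwitz1986, §3] [cite: Rogawski1990, §4.9 Lemma 4.9.3] -/
theorem ncard_selfDual_fixed_sep_eq_of_formCongr (σ : K →+* K) (ϖ : K) (H : Matrix (Fin N) (Fin N) K) (P γ : GL (Fin N) K)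
    (Q₁ Q₂ : Submodule 𝒪[K] (Fin N → K) → Prop) (hQ : ∀ M, Q₁ (mapGL P M) ↔ Q₂ M) :
    {M : Submodule 𝒪[K] (Fin N → K) | IsSelfDualLattice σ ϖ H M ∧ mapGL (P * γ * P⁻¹) M = M ∧ Q₁ M}.ncard =
      {M : Submodule 𝒪[K] (Fin N → K) | IsSelfDualLattice σ ϖ (formCongr σ P H) M ∧ mapGL γ M = M ∧ Q₂ M}.ncard := by
  have himage : {M : Submodule 𝒪[K] (Fin N → K) | IsSelfDualLattice σ ϖ H M ∧ mapGL (P * γ * P⁻¹) M = M ∧ Q₁ M} =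
      mapGL P '' {M : Submodule 𝒪[K] (Fin N → K) | IsSelfDualLattice σ ϖ (formCongr σ P H) M ∧ mapGL γ M = M ∧ Q₂ M} := by
    ext M'
    simp only [Set.mem_setOf_eq, Set.mem_image]
    constructor
    · rintro ⟨hsd, hfix, hQ₁⟩
      have hM' : mapGL P (mapGL P⁻¹ M') = M' := by rw [← mapGL_mul, mul_inv_cancel, mapGL_one]
      refine ⟨mapGL P⁻¹ M', ⟨?_, ?_, ?_⟩, hM'⟩
      · rwa [isSelfDualLattice_formCongr_iff (σ := σ) (ϖ := ϖ), hM']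
      · rwa [← mapGL_conj_mapGL_eq_iff P, hM']
      · rwa [← hQ, hM']
    · rintro ⟨M, ⟨hsd, hfix, hQ₂⟩, rfl⟩
      exact ⟨(isSelfDualLattice_formCongr_iff (σ := σ) (ϖ := ϖ) P H M).1 hsd, (mapGL_conj_mapGL_eq_iff P γ M).2 hfix, (hQ M).2 hQ₂⟩
  rw [himage, Set.ncard_image_of_injective _ (mapGL_injective P)]

/-- **COUNT TRANSPORT, stratum «bd» (`¬ (γ−1)M ⊆ ϖM`).** [cite: Rogawski1990, §4.9 p. 55] [cite: Kottwitz1986, §3] -/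
theorem ncard_selfDual_fixed_bd_eq_of_formCongr (σ : K →+* K) (ϖ : K) (H : Matrix (Fin N) (Fin N) K) (P γ : GL (Fin N) K) :
    {M : Submodule 𝒪[K] (Fin N → K) | IsSelfDualLattice σ ϖ H M ∧ mapGL (P * γ * P⁻¹) M = M ∧
        ¬ M.map ((Matrix.toLin' (((P * γ * P⁻¹ : GL (Fin N) K) : Matrix (Fin N) (Fin N) K) - 1)).restrictScalars 𝒪[K]) ≤ scaleLattice ϖ M}.ncard =
      {M : Submodule 𝒪[K] (Fin N → K) | IsSelfDualLattice σ ϖ (formCongr σ P H) M ∧ mapGL γ M = M ∧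
        ¬ M.map ((Matrix.toLin' ((γ : Matrix (Fin N) (Fin N) K) - 1)).restrictScalars 𝒪[K]) ≤ scaleLattice ϖ M}.ncard :=
  ncard_selfDual_fixed_sep_eq_of_formCongr σ ϖ H P γ _ _ fun M => by rw [map_conj_sub_one_le_scaleLattice_iff]

/-- **COUNT TRANSPORT, stratum «0» (`(γ−1)M ⊆ ϖ²M`).** [cite: Rogawski1990, §4.9 p. 55] [cite: Kottwitz1986, §3] -/
theorem ncard_selfDual_fixed_deep_eq_of_formCongr (σ : K →+* K) (ϖ : K) (H : Matrix (Fin N) (Fin N) K) (P γ : GL (Fin N) K) :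
    {M : Submodule 𝒪[K] (Fin N → K) | IsSelfDualLattice σ ϖ H M ∧ mapGL (P * γ * P⁻¹) M = M ∧
        M.map ((Matrix.toLin' (((P * γ * P⁻¹ : GL (Fin N) K) : Matrix (Fin N) (Fin N) K) - 1)).restrictScalars 𝒪[K]) ≤ scaleLattice (ϖ ^ 2) M}.ncard =
      {M : Submodule 𝒪[K] (Fin N → K) | IsSelfDualLattice σ ϖ (formCongr σ P H) M ∧ mapGL γ M = M ∧
        M.map ((Matrix.toLin' ((γ : Matrix (Fin N) (Fin N) K) - 1)).restrictScalars 𝒪[K]) ≤ scaleLattice (ϖ ^ 2) M}.ncard :=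
  ncard_selfDual_fixed_sep_eq_of_formCongr σ ϖ H P γ _ _ fun M => by rw [map_conj_sub_one_le_scaleLattice_iff]

/-- **COUNT TRANSPORT, stratum «reg» (`(γ−1)M ⊆ ϖM`, `¬ ⊆ ϖ²M`, `¬ (γ−1)²M ⊆ ϖ³M`).** [cite: Rogawski1990, §4.9 p. 55] [cite: Kottwitz1986, §3] -/
theorem ncard_selfDual_fixed_reg_eq_of_formCongr (σ : K →+* K) (ϖ : K) (H : Matrix (Fin N) (Fin N) K) (P γ : GL (Fin N) K) :
    {M : Submodule 𝒪[K] (Fin N → K) | IsSelfDualLattice σ ϖ H M ∧ mapGL (P * γ * P⁻¹) M = M ∧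
        (M.map ((Matrix.toLin' (((P * γ * P⁻¹ : GL (Fin N) K) : Matrix (Fin N) (Fin N) K) - 1)).restrictScalars 𝒪[K]) ≤ scaleLattice ϖ M ∧
          ¬ M.map ((Matrix.toLin' (((P * γ * P⁻¹ : GL (Fin N) K) : Matrix (Fin N) (Fin N) K) - 1)).restrictScalars 𝒪[K]) ≤ scaleLattice (ϖ ^ 2) M ∧
            ¬ M.map ((Matrix.toLin' ((((P * γ * P⁻¹ : GL (Fin N) K) : Matrix (Fin N) (Fin N) K) - 1) ^ 2)).restrictScalars 𝒪[K]) ≤ scaleLattice (ϖ ^ 3) M)}.ncard =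
      {M : Submodule 𝒪[K] (Fin N → K) | IsSelfDualLattice σ ϖ (formCongr σ P H) M ∧ mapGL γ M = M ∧
        (M.map ((Matrix.toLin' ((γ : Matrix (Fin N) (Fin N) K) - 1)).restrictScalars 𝒪[K]) ≤ scaleLattice ϖ M ∧
          ¬ M.map ((Matrix.toLin' ((γ : Matrix (Fin N) (Fin N) K) - 1)).restrictScalars 𝒪[K]) ≤ scaleLattice (ϖ ^ 2) M ∧
            ¬ M.map ((Matrix.toLin' (((γ : Matrix (Fin N) (Fin N) K) - 1) ^ 2)).restrictScalars 𝒪[K]) ≤ scaleLattice (ϖ ^ 3) M)}.ncard :=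
  ncard_selfDual_fixed_sep_eq_of_formCongr σ ϖ H P γ _ _ fun M => by
    rw [map_conj_sub_one_le_scaleLattice_iff, map_conj_sub_one_le_scaleLattice_iff, map_conj_sub_one_sq_le_scaleLattice_iff]

/-- **COUNT TRANSPORT, the rank-one strata «1□_c»** (`(γ−1)M ⊆ ϖM`, `¬ ⊆ ϖ²M`, `(γ−1)²M ⊆ ϖ³M`, class token with constant `c`): the class constant and the normalising
`ϖ′ = ϖ⁻¹` are the same on both sides because the FORM moves with the basis (`B_H(Py, Pz) = B_{ᵗσ(P)HP}(y, z)`). [cite: Rogawski1990, §4.9 p. 55] [cite: Kottwitz1986, §3] -/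
theorem ncard_selfDual_fixed_rankOne_eq_of_formCongr (σ : K →+* K) (ϖ : K) (H : Matrix (Fin N) (Fin N) K) (P γ : GL (Fin N) K) (ϖ' c : K) :
    {M : Submodule 𝒪[K] (Fin N → K) | IsSelfDualLattice σ ϖ H M ∧ mapGL (P * γ * P⁻¹) M = M ∧
        (M.map ((Matrix.toLin' (((P * γ * P⁻¹ : GL (Fin N) K) : Matrix (Fin N) (Fin N) K) - 1)).restrictScalars 𝒪[K]) ≤ scaleLattice ϖ M ∧
          ¬ M.map ((Matrix.toLin' (((P * γ * P⁻¹ : GL (Fin N) K) : Matrix (Fin N) (Fin N) K) - 1)).restrictScalars 𝒪[K]) ≤ scaleLattice (ϖ ^ 2) M ∧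
            M.map ((Matrix.toLin' ((((P * γ * P⁻¹ : GL (Fin N) K) : Matrix (Fin N) (Fin N) K) - 1) ^ 2)).restrictScalars 𝒪[K]) ≤ scaleLattice (ϖ ^ 3) M ∧
              ∃ y ∈ M, ∃ a : K, Valued.v a = 1 ∧
                Valued.v (ϖ' * pairing σ H y ((((P * γ * P⁻¹ : GL (Fin N) K) : Matrix (Fin N) (Fin N) K) - 1) *ᵥ y) - c * a ^ 2) < 1)}.ncard =
      {M : Submodule 𝒪[K] (Fin N → K) | IsSelfDualLattice σ ϖ (formCongr σ P H) M ∧ mapGL γ M = M ∧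
        (M.map ((Matrix.toLin' ((γ : Matrix (Fin N) (Fin N) K) - 1)).restrictScalars 𝒪[K]) ≤ scaleLattice ϖ M ∧
          ¬ M.map ((Matrix.toLin' ((γ : Matrix (Fin N) (Fin N) K) - 1)).restrictScalars 𝒪[K]) ≤ scaleLattice (ϖ ^ 2) M ∧
            M.map ((Matrix.toLin' (((γ : Matrix (Fin N) (Fin N) K) - 1) ^ 2)).restrictScalars 𝒪[K]) ≤ scaleLattice (ϖ ^ 3) M ∧
              ∃ y ∈ M, ∃ a : K, Valued.v a = 1 ∧
                Valued.v (ϖ' * pairing σ (formCongr σ P H) y (((γ : Matrix (Fin N) (Fin N) K) - 1) *ᵥ y) - c * a ^ 2) < 1)}.ncard :=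
  ncard_selfDual_fixed_sep_eq_of_formCongr σ ϖ H P γ _ _ fun M => by
    rw [map_conj_sub_one_le_scaleLattice_iff, map_conj_sub_one_le_scaleLattice_iff, map_conj_sub_one_sq_le_scaleLattice_iff, exists_mem_mapGL_class_iff]

end Literature.NumberTheory.Automorphic.UnitaryLatticeTree
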